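import Literature.Geometry.Kaehler.ComplexTorusTranscendentalLatticeAllDegreesHodgeTypes
import Literature.Analysis.Complex.PQDimension
import HarnessLib

/-!
# The Hodge numbers of the transcendental Hodge structure in every degree: `T^l ⊗ ℂ = ⊕_{r+s=l} (T^l ⊗ ℂ)^{r,s}` with
# `(T^l ⊗ ℂ)^{r,s} = H^{r,s}(X)` (`dim = C(g,r)·C(g,s)`) for `r ≠ s` and `dim (T^l ⊗ ℂ)^{q,q} = C(g,q)² − rk Hdg^{k,p}(X, ℤ)` (`l = 2q`)

Layer `Literature/Geometry/Kaehler`, namespace `Literature.Geometry.Kaehler.ComplexTorus`; lane `lit-hodgefound` (Track 2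
foundations library), seat p09, generation 32, row g32-#6. THEOREMS ONLY (0 definitions); no named fact, net debt 0. Sequel of
`ComplexTorusTranscendentalLatticeAllDegreesHodgeTypes` (g32-#3): for a complex torus `X = E/Φ(ℤ^ι)` of dimension `g` (`|ι| = 2g`),
complementary degrees `k + l = 2g` and the degree-`l` transcendental lattice `T = Hdg^{k,p}(X, ℤ)^⊥ ∩ Hˡ(X, ℤ)` (g31-#11, written out),
g32-#3 proved that `W := T ⊗ ℂ = span_ℂ T ⊆ Hˡ(X, ℂ)` is a sub-Hodge structure (`typeProjAt`-stable) containing every `H^{r,s}(X)`, `r ≠ s`,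
of dimension `C(2g, l) − rk Hdg^{k,p}(X, ℤ)`. THIS file computes its Hodge decomposition and Hodge numbers `dim_ℂ (W ∩ Λ^{r,s})`:

* §1 the type projection `π^{a,b}` on `Hˡ(X, ℂ)`: `im π^{a,b} = Λ^{a,b}` and `dim Λ^{a,b} + dim ker π^{a,b} = dim Hˡ(X, ℂ)`.
* §2 **`W = ⊕_{r+s=l} (W ∩ Λ^{r,s})`** (independent pieces with supremum `W`; `π^{a,b}(W) = W ∩ Λ^{a,b}`).
* §3 **`(W)^{r,s} = Λ^{r,s} = H^{r,s}(X)` for `r ≠ s`**, so **`h^{r,s}(T) = C(g,r)·C(g,s)`** (the tree's pointwise Hodge numbers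
  `finrank_typeSubmodule`, Lange Prop. 1.1.23).
* §4 the diagonal Hodge number, `l = 2q`: `ker π^{q,q} = ⊕_{r≠s} Λ^{r,s} ⊆ W`, and rank–nullity for `π^{q,q}|_W` against `π^{q,q}` gives
  **`h^{q,q}(T) + rk Hdg^{k,p}(X, ℤ) = h^{q,q}(X) = C(g,q)²`** — the Hodge classes of the complementary degree are exactly what the
  transcendental part loses on the diagonal (for a surface, `g = 2`, `l = k = 2`, `q = p = 1`: `h^{1,1}(T(X)) = 4 − ρ(X)`, Shioda–Mitani /
  Huybrechts Ch. 3 for abelian surfaces: `rk T(X) = 6 − ρ(X)`, `T ⊗ ℂ = H^{2,0} ⊕ (T ⊗ ℂ)^{1,1} ⊕ H^{0,2}`).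

## Contents (theorems only)

* §1 `range_typeProjₗ_eq_typeSubmodule`, `finrank_typeSubmodule_add_finrank_ker_typeProjₗ`.
* §2 **`map_typeProjₗ_span_complex_integralHodgeAnnihilator`** (`π^{a,b}(W) = W ∩ Λ^{a,b}`),
  **`iSup_span_complex_integralHodgeAnnihilator_inf_typeSubmodule`** (`⊔_{r+s=l} (W ∩ Λ^{r,s}) = W`),
  `iSupIndep_span_complex_integralHodgeAnnihilator_inf_typeSubmodule`.
* §3 **`span_complex_integralHodgeAnnihilator_inf_typeSubmodule_of_ne`** (`W ∩ Λ^{r,s} = Λ^{r,s}`, `r ≠ s`),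
  **`finrank_span_complex_integralHodgeAnnihilator_inf_typeSubmodule_of_ne`** (`= C(g,r)·C(g,s)`).
* §4 `ker_typeProjₗ_le_span_complex_integralHodgeAnnihilator` (`ker π^{q,q} ⊆ W`),
  **`finrank_span_complex_integralHodgeAnnihilator_inf_typeSubmodule_add`** (`h^{q,q}(T) + rk Hdg^{k,p} = dim Λ^{q,q}`),
  **`finrank_span_complex_integralHodgeAnnihilator_inf_typeSubmodule_eq_choose_sq_sub`** (`h^{q,q}(T) = C(g,q)² − rk Hdg^{k,p}`; the bound
  `rk Hdg ≤ C(g,p)² = C(g,q)²` itself is the tree's `finrank_hodgeClasses_le_choose_sq` / `finrank_hodgeClassesIn_le_finrank_typeSubmodule`, not restated).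

## References

* [cite: Huybrechts2016K3, Ch. 3 §2.2–2.3 (PDF pp. 58–59: `T(X)` an irreducible Hodge structure of K3 type, `T(X) ⊗ ℂ ⊇ H^{2,0}`; abelian surfaces); §1.1 (PDF p. 49: sub-Hodge structures, Hodge numbers)]
* [cite: ShiodaMitani1974, §1 (pp. 152–153: `rank T_X = 6 − ρ(X)` for an abelian surface) and §3 (3.19)]
* [cite: Lange2023AbelianVarietiesComplex, §1.1.5 Prop. 1.1.23 and Thm. 1.1.21 (`h^{p,q} = C(g,p)·C(g,q)`); §1.1.3 Cor. 1.1.19; §7.2.2]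
* [cite: VoisinHodgeI2002, §2.3.1 eq. (2.4); §7.1.1 (Hodge structures, sub-structures); §11.3.1]
-/

noncomputable section

open Module Function Finset
open Literature.Analysis.Complex (IsOfTypeAt typeProjAt typeProjₗ typeProjₗ_apply typeSubmodule isOfTypeAt_typeProjAt
  typeProjAt_of_ne typeProjAt_typeProjAt_self mem_typeSubmodule_iff mem_typeSubmodule_iff_isOfTypeAt sum_antidiagonal_typeProjAt
  finrank_typeSubmodule iSupIndep_typeSubmodule)

namespace Literature.Geometry.Kaehler.ComplexTorus

section HodgeNumbers

variable {ι : Type*} [Fintype ι] [DecidableEq ι] {E : Type*} [NormedAddCommGroup E] [NormedSpace ℂ E]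
  (Φ : (ι → ℝ) ≃L[ℝ] E) {n k l : ℕ} (e : Fin n ≃ ι) (h : k + l = n) (p : ℕ)

/-! ## §1 The type projections on `Hˡ(X, ℂ)` -/

omit [Fintype ι] [DecidableEq ι] in
/-- `im π^{a,b} = Λ^{a,b}` for `a + b = l`. [cite: VoisinHodgeI2002, §2.3.1 eq. (2.4)] -/
theorem range_typeProjₗ_eq_typeSubmodule {a b : ℕ} (hab : a + b = l) :
    LinearMap.range (typeProjₗ (E := E) (k := l) a b) = typeSubmodule E l a b := by
  refine le_antisymm ?_ fun η hη ↦ ⟨η, by rw [typeProjₗ_apply]; exact mem_typeSubmodule_iff.1 hη⟩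
  rintro _ ⟨η, rfl⟩
  rw [typeProjₗ_apply]
  exact (isOfTypeAt_typeProjAt hab η).mem_typeSubmodule

include Φ in
omit [DecidableEq ι] in
/-- Rank–nullity for a type projection: `dim Λ^{a,b} + dim ker π^{a,b} = dim Hˡ(X, ℂ)`. [cite: VoisinHodgeI2002, §2.3.1 eq. (2.4)] -/
theorem finrank_typeSubmodule_add_finrank_ker_typeProjₗ {a b : ℕ} (hab : a + b = l) :
    finrank ℂ (typeSubmodule E l a b) + finrank ℂ (LinearMap.ker (typeProjₗ (E := E) (k := l) a b)) =
      finrank ℂ (E [⋀^Fin l]→L[ℝ] ℂ) := by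
  haveI := finiteDimensional_alt_complex Φ l
  rw [← range_typeProjₗ_eq_typeSubmodule hab]
  exact LinearMap.finrank_range_add_finrank_ker _

/-! ## §2 `T ⊗ ℂ = ⊕_{r+s=l} (T ⊗ ℂ) ∩ Λ^{r,s}` -/

/-- **`π^{a,b}(T ⊗ ℂ) = (T ⊗ ℂ) ∩ Λ^{a,b}`**: the type components of the complexified transcendental lattice are its intersections with the
type spaces (`T ⊗ ℂ` is `typeProjAt`-stable, g32-#3). [cite: Huybrechts2016K3, §1.1 (PDF p. 49) and Ch. 3 §2.2] [cite: VoisinHodgeI2002, §7.1.1] -/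
theorem map_typeProjₗ_span_complex_integralHodgeAnnihilator [FiniteDimensional ℂ E] (a b : ℕ) :
    (Submodule.span ℂ ((integralForms Φ l ⊓ ⨅ s : integralHodgeClassesIn Φ k p,
        (LinearMap.ker (poincarePairing Φ e h (s : E [⋀^Fin k]→L[ℝ] ℂ))).toAddSubgroup :
          AddSubgroup (E [⋀^Fin l]→L[ℝ] ℂ)) : Set (E [⋀^Fin l]→L[ℝ] ℂ))).map (typeProjₗ a b) =
      Submodule.span ℂ ((integralForms Φ l ⊓ ⨅ s : integralHodgeClassesIn Φ k p,
        (LinearMap.ker (poincarePairing Φ e h (s : E [⋀^Fin k]→L[ℝ] ℂ))).toAddSubgroup :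
          AddSubgroup (E [⋀^Fin l]→L[ℝ] ℂ)) : Set (E [⋀^Fin l]→L[ℝ] ℂ)) ⊓ typeSubmodule E l a b := by
  refine le_antisymm ?_ fun w hw ↦ Submodule.mem_map.2 ⟨w, hw.1, by rw [typeProjₗ_apply]; exact mem_typeSubmodule_iff.1 hw.2⟩
  rintro _ ⟨w, hw, rfl⟩
  rw [typeProjₗ_apply]
  exact ⟨typeProjAt_mem_span_complex_integralHodgeAnnihilator Φ e h p hw a b, mem_typeSubmodule_iff.2 (typeProjAt_typeProjAt_self a b w)⟩

/-- **`T ⊗ ℂ = ⊔_{r+s=l} (T ⊗ ℂ) ∩ Λ^{r,s}`** — the Hodge decomposition of the transcendental part (`w = ∑ π^{r,s} w` with every component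
in `T ⊗ ℂ`). [cite: Huybrechts2016K3, §1.1 (PDF p. 49) and Ch. 3 §2.2–2.3] [cite: VoisinHodgeI2002, §2.3.1 eq. (2.4) and §7.1.1] -/
theorem iSup_span_complex_integralHodgeAnnihilator_inf_typeSubmodule [FiniteDimensional ℂ E] :
    ⨆ pq : ↥(antidiagonal l), Submodule.span ℂ ((integralForms Φ l ⊓ ⨅ s : integralHodgeClassesIn Φ k p,
        (LinearMap.ker (poincarePairing Φ e h (s : E [⋀^Fin k]→L[ℝ] ℂ))).toAddSubgroup :
          AddSubgroup (E [⋀^Fin l]→L[ℝ] ℂ)) : Set (E [⋀^Fin l]→L[ℝ] ℂ)) ⊓ typeSubmodule E l pq.1.1 pq.1.2 =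
      Submodule.span ℂ ((integralForms Φ l ⊓ ⨅ s : integralHodgeClassesIn Φ k p,
        (LinearMap.ker (poincarePairing Φ e h (s : E [⋀^Fin k]→L[ℝ] ℂ))).toAddSubgroup :
          AddSubgroup (E [⋀^Fin l]→L[ℝ] ℂ)) : Set (E [⋀^Fin l]→L[ℝ] ℂ)) := by
  refine le_antisymm (iSup_le fun pq ↦ inf_le_left) fun w hw ↦ ?_
  rw [← sum_antidiagonal_typeProjAt w]
  refine Submodule.sum_mem _ fun pq hpq ↦ ?_
  exact Submodule.mem_iSup_of_mem (⟨pq, hpq⟩ : ↥(antidiagonal l))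
    ⟨typeProjAt_mem_span_complex_integralHodgeAnnihilator Φ e h p hw pq.1 pq.2,
      (isOfTypeAt_typeProjAt (mem_antidiagonal.1 hpq) w).mem_typeSubmodule⟩

omit [Fintype ι] in
/-- The pieces `(T ⊗ ℂ) ∩ Λ^{r,s}`, `r + s = l`, are independent (sub-pieces of the direct sum `Hˡ = ⊕ Λ^{r,s}`).
[cite: VoisinHodgeI2002, §2.3.1 eq. (2.4)] -/
theorem iSupIndep_span_complex_integralHodgeAnnihilator_inf_typeSubmodule :
    iSupIndep fun pq : ↥(antidiagonal l) ↦ Submodule.span ℂ ((integralForms Φ l ⊓ ⨅ s : integralHodgeClassesIn Φ k p,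
        (LinearMap.ker (poincarePairing Φ e h (s : E [⋀^Fin k]→L[ℝ] ℂ))).toAddSubgroup :
          AddSubgroup (E [⋀^Fin l]→L[ℝ] ℂ)) : Set (E [⋀^Fin l]→L[ℝ] ℂ)) ⊓ typeSubmodule E l pq.1.1 pq.1.2 :=
  (iSupIndep_typeSubmodule (E := E) (k := l)).mono fun _ ↦ inf_le_right

/-! ## §3 The off-diagonal Hodge numbers of `T`: `h^{r,s}(T) = h^{r,s}(X) = C(g,r)·C(g,s)` for `r ≠ s` -/

/-- **`(T ⊗ ℂ) ∩ Λ^{r,s} = Λ^{r,s} = H^{r,s}(X)` for `r ≠ s`** (g32-#3: `H^{r,s} ⊆ T ⊗ ℂ`).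
[cite: Huybrechts2016K3, Ch. 3 Def. 2.5 (PDF p. 58: `V^{2,0} = T^{2,0}`)] [cite: VoisinHodgeI2002, §11.3.1] -/
theorem span_complex_integralHodgeAnnihilator_inf_typeSubmodule_of_ne [FiniteDimensional ℂ E] {r s : ℕ} (hrs : r ≠ s) :
    Submodule.span ℂ ((integralForms Φ l ⊓ ⨅ s : integralHodgeClassesIn Φ k p,
        (LinearMap.ker (poincarePairing Φ e h (s : E [⋀^Fin k]→L[ℝ] ℂ))).toAddSubgroup :
          AddSubgroup (E [⋀^Fin l]→L[ℝ] ℂ)) : Set (E [⋀^Fin l]→L[ℝ] ℂ)) ⊓ typeSubmodule E l r s = typeSubmodule E l r s :=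
  inf_eq_right.2 (typeSubmodule_le_span_complex_integralHodgeAnnihilator Φ e h p hrs)

/-- **`h^{r,s}(T) = C(g,r)·C(g,s)` for `r ≠ s`, `r + s = l`** (`g = dim_ℂ X`): the transcendental part carries ALL of `H^{r,s}(X)` off the
diagonal. [cite: Lange2023AbelianVarietiesComplex, §1.1.5 Prop. 1.1.23 and Thm. 1.1.21] [cite: Huybrechts2016K3, Ch. 3 §2.2–2.3] -/
theorem finrank_span_complex_integralHodgeAnnihilator_inf_typeSubmodule_of_ne [FiniteDimensional ℂ E] {r s : ℕ} (hrs : r ≠ s)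
    (hl : r + s = l) :
    finrank ℂ ↥(Submodule.span ℂ ((integralForms Φ l ⊓ ⨅ s : integralHodgeClassesIn Φ k p,
        (LinearMap.ker (poincarePairing Φ e h (s : E [⋀^Fin k]→L[ℝ] ℂ))).toAddSubgroup :
          AddSubgroup (E [⋀^Fin l]→L[ℝ] ℂ)) : Set (E [⋀^Fin l]→L[ℝ] ℂ)) ⊓ typeSubmodule E l r s) =
      (finrank ℂ E).choose r * (finrank ℂ E).choose s := by
  rw [span_complex_integralHodgeAnnihilator_inf_typeSubmodule_of_ne Φ e h p hrs, finrank_typeSubmodule hl]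

/-! ## §4 The diagonal Hodge number of `T`: `h^{q,q}(T) = C(g,q)² − rk Hdg^{k,p}(X, ℤ)` (`l = 2q`) -/

/-- `ker π^{q,q} = ⊕_{r ≠ s} Λ^{r,s} ⊆ T ⊗ ℂ` (`l = 2q`). [cite: Huybrechts2016K3, Ch. 3 Def. 2.5 (PDF p. 58)] [cite: VoisinHodgeI2002, §2.3.1 eq. (2.4)] -/
theorem ker_typeProjₗ_le_span_complex_integralHodgeAnnihilator [FiniteDimensional ℂ E] {q : ℕ} (hq : q + q = l) :
    LinearMap.ker (typeProjₗ (E := E) (k := l) q q) ≤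
      Submodule.span ℂ ((integralForms Φ l ⊓ ⨅ s : integralHodgeClassesIn Φ k p,
        (LinearMap.ker (poincarePairing Φ e h (s : E [⋀^Fin k]→L[ℝ] ℂ))).toAddSubgroup :
          AddSubgroup (E [⋀^Fin l]→L[ℝ] ℂ)) : Set (E [⋀^Fin l]→L[ℝ] ℂ)) := by
  intro η hη
  rw [LinearMap.mem_ker, typeProjₗ_apply] at hη
  rw [← sum_antidiagonal_typeProjAt η]
  refine Submodule.sum_mem _ fun pq hpq ↦ ?_
  have hsum := mem_antidiagonal.1 hpq
  by_cases hd : pq.1 = pq.2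
  · have h1 : pq.1 = q := by omega
    have h2 : pq.2 = q := by omega
    rw [h1, h2, hη]
    exact Submodule.zero_mem _
  · exact typeSubmodule_le_span_complex_integralHodgeAnnihilator Φ e h p hd (isOfTypeAt_typeProjAt hsum η).mem_typeSubmodule

/-- **`h^{q,q}(T) + rk Hdg^{k,p}(X, ℤ) = h^{q,q}(X) = dim Λ^{q,q}(Hˡ)`** (`l = 2q`, `k + l = 2g`): rank–nullity for `π^{q,q}` on `T ⊗ ℂ ⊇ ker π^{q,q}`
(`dim T ⊗ ℂ = dim (T ⊗ ℂ)^{q,q} + dim ker π^{q,q}`) against `π^{q,q}` on `Hˡ` (`dim Hˡ = dim Λ^{q,q} + dim ker π^{q,q}`) and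
`dim T ⊗ ℂ + rk Hdg^{k,p} = dim Hˡ` (g31-#11, g32-#3). For an abelian surface (`g = 2`, `k = l = 2`): `rk T(X) = 6 − ρ(X)`, `h^{1,1}(T(X)) = 4 − ρ(X)`.
[cite: ShiodaMitani1974, §1 (pp. 152–153)] [cite: Huybrechts2016K3, Ch. 3 §2.2–2.3 (PDF pp. 58–59)] [cite: Lange2023AbelianVarietiesComplex, §1.1.5 Prop. 1.1.23] -/
theorem finrank_span_complex_integralHodgeAnnihilator_inf_typeSubmodule_add [FiniteDimensional ℂ E] {q : ℕ} (hq : q + q = l) :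
    finrank ℂ ↥(Submodule.span ℂ ((integralForms Φ l ⊓ ⨅ s : integralHodgeClassesIn Φ k p,
        (LinearMap.ker (poincarePairing Φ e h (s : E [⋀^Fin k]→L[ℝ] ℂ))).toAddSubgroup :
          AddSubgroup (E [⋀^Fin l]→L[ℝ] ℂ)) : Set (E [⋀^Fin l]→L[ℝ] ℂ)) ⊓ typeSubmodule E l q q) +
      finrank ℤ (integralHodgeClassesIn Φ k p) = finrank ℂ (typeSubmodule E l q q) := by
  haveI := finiteDimensional_alt_complex Φ l
  set W := Submodule.span ℂ ((integralForms Φ l ⊓ ⨅ s : integralHodgeClassesIn Φ k p,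
        (LinearMap.ker (poincarePairing Φ e h (s : E [⋀^Fin k]→L[ℝ] ℂ))).toAddSubgroup :
          AddSubgroup (E [⋀^Fin l]→L[ℝ] ℂ)) : Set (E [⋀^Fin l]→L[ℝ] ℂ)) with hW
  -- rank–nullity for `π^{q,q}` restricted to `W` (its kernel is all of `ker π^{q,q} ⊆ W`, its image `W ∩ Λ^{q,q}`)
  have hker : LinearMap.ker (typeProjₗ (E := E) (k := l) q q) ≤ W := ker_typeProjₗ_le_span_complex_integralHodgeAnnihilator Φ e h p hq
  have h1 := LinearMap.finrank_range_add_finrank_ker (K := ℂ) (V := ↥W) (V₂ := E [⋀^Fin l]→L[ℝ] ℂ)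
    ((typeProjₗ (E := E) (k := l) q q) ∘ₗ W.subtype)
  rw [LinearMap.range_comp, Submodule.range_subtype, hW, map_typeProjₗ_span_complex_integralHodgeAnnihilator Φ e h p q q, ← hW,
    LinearMap.ker_comp, (Submodule.comapSubtypeEquivOfLe hker).finrank_eq] at h1
  -- rank–nullity for `π^{q,q}` on `Hˡ`, and `dim W + rk Hdg = dim Hˡ`
  have h2 := finrank_typeSubmodule_add_finrank_ker_typeProjₗ Φ (E := E) hq
  have h3 : finrank ℂ W + finrank ℤ (integralHodgeClassesIn Φ k p) = finrank ℂ (E [⋀^Fin l]→L[ℝ] ℂ) := by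
    rw [hW, finrank_span_complex_integralHodgeAnnihilator_eq_finrank Φ e h p, finrank_alt_complex_eq_choose Φ l]
    exact finrank_integralHodgeAnnihilator_add_finrank_integralHodgeClassesIn Φ e h p
  omega

/-- **`h^{q,q}(T) = C(g,q)² − rk Hdg^{k,p}(X, ℤ)`** (`l = 2q`, `k + l = 2g`, `g = dim_ℂ X`).
[cite: ShiodaMitani1974, §1 (pp. 152–153)] [cite: Lange2023AbelianVarietiesComplex, §1.1.5 Prop. 1.1.23] [cite: Huybrechts2016K3, Ch. 3 §2.2–2.3] -/
theorem finrank_span_complex_integralHodgeAnnihilator_inf_typeSubmodule_eq_choose_sq_sub [FiniteDimensional ℂ E] {q : ℕ} (hq : q + q = l) :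
    finrank ℂ ↥(Submodule.span ℂ ((integralForms Φ l ⊓ ⨅ s : integralHodgeClassesIn Φ k p,
        (LinearMap.ker (poincarePairing Φ e h (s : E [⋀^Fin k]→L[ℝ] ℂ))).toAddSubgroup :
          AddSubgroup (E [⋀^Fin l]→L[ℝ] ℂ)) : Set (E [⋀^Fin l]→L[ℝ] ℂ)) ⊓ typeSubmodule E l q q) =
      (finrank ℂ E).choose q ^ 2 - finrank ℤ (integralHodgeClassesIn Φ k p) := by
  have h1 := finrank_span_complex_integralHodgeAnnihilator_inf_typeSubmodule_add Φ e h p hq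
  rw [finrank_typeSubmodule hq, ← sq] at h1
  omega

end HodgeNumbers

end Literature.Geometry.Kaehler.ComplexTorus
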